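import Summits.SmoothPoincare4.SmoothPoincare4.Theorems.WeakReductionDescentDependentTripleGenusThreeStandard
import Literature.Topology.FourManifolds.DependentTripleGenusThreeTrisectionsProofs
import Literature.Topology.FourManifolds.LoopSurgeryHomotopySphereGKProofs
import Literature.Barriers.SmoothPoincare4.LowGenusTrisectionsStandardOfClassification

/-!
# Crux `WeakReductionDescent.DependentTripleGenusThreeStandard` (stmt-SmoothPoincare4-18000), line
# `Sketch`: the sorry-free REDUCTION of the crux to its four registered stubs, and the free half of
# Aranda–Zupan's Lemma 5.4 for homotopy 4-spheres

Helper file (`--supports stmt-SmoothPoincare4-18000`) of the registered skeleton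
`Cruxes/DependentTripleGenusThreeStandard/Lines/Sketch.lean` (v3).  The apex stub of that skeleton
is the LOOP-PARTNER STEP of Aranda–Zupan 2025 §7 configuration (3) (arXiv:2503.04607, pp. 25–26):
a `(3; 1,1,1)`-trisected `M ≃ₕ S⁴` with a pants-type triple that is not weakly reducible is a
circle surgery on a loop of some `X′` carrying a low-genus GK-trisection.  The Literature side
tracks that step (`hP` of `DependentTripleGenusThreeTrisectionsProofs`) with three extra clauses in
its conclusion — genus EXACTLY `2`, the Meier–Schirmer–Zupan range `∃ i, 2 ≤ k′ i + 1` (Lemma 5.4: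
"`(Σ_{α₁}; α′, β′, γ′)` is a `(g − 1; k₁, k₂, k₃ + 1)`-trisection diagram") and the smoothness of
the loop `ℓ`.  For a HOMOTOPY 4-SPHERE all three are consequences of PROVED tree theorems, which is
what this file records:

* `mszRange_of_isCircleSurgery_of_genus_le_two` — if `M ≃ₕ S⁴` is `IsCircleSurgery X′ M ℓ` and
  `X′` carries a `(g′; k′)`-GK-trisection with `g′ ≤ 2`, then `∃ i, g′ ≤ k′ i + 1`: `ℓ` is smooth
  (`CircleNbhd.isSmoothEmbedding_core`), `X′` is compact, connected (`IsGKTrisection.compactSpace`,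
  `.connectedSpace`) and orientable (`isOrientable_of_isCircleSurgery_four_holds`), so
  `k′₀ + k′₁ + k′₂ = g′ + 2` (`gkTrisection_sum_eq_add_two_of_loopSurgery_homotopySphere_holds`,
  i.e. `χ(X′) = χ(M) − 2 = 0`), and pigeonhole.
* `nonempty_diffeomorph_sphere_of_isCircleSurgery_of_genus_le_two` — hence, GIVEN the tree's
  loop-surgery fact `msz_loopSurgery_homotopySphere_gk`, such an `M` is `≅ S⁴`
  (`Literature.Barriers.SmoothPoincare4.nonempty_diffeomorph_sphere_of_isCircleSurgery_of_mszRange`).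
* `helper_pantsTriple_of_loopSurgery_of_loopPartnerNoRange` (REGISTERED helper of the crux) — the
  pants-triple statement `hp` at type `(1,1,1)` (verbatim the hypothesis of the tree's
  `notWeaklyReducibleCore_of_separatingPair_of_pantsTriple_type (fun _ => 1)`) from the
  loop-surgery fact and the WEAKENED loop-partner step `stub_loopPartnerNoRange` of the skeleton
  (conclusion: some `X′` with a GK-trisection of genus `≤ 2`, any type, and
  `IsCircleSurgery X′ M ℓ` — nothing else).
* `helper_notWeaklyReducibleCore_of_stubs` (REGISTERED helper) — the not-weakly-reducible core of
  the Literature fact at type `(1,1,1)` (verbatim the hypothesis `hcore` of the tree's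
  `arandaZupan_dependentTriple_genusThree_homotopySphere_of_facts_of_notWeaklyReducible`) from the
  loop-surgery fact and the two Aranda–Zupan-specific stubs of the skeleton: stub 3
  `stub_separatingPairWeaklyReducible` (§7 configurations (1)–(2): a separating pair in the triple
  makes `T` weakly reducible — the printed USE of Lemma 3.8) and stub 4 `stub_loopPartnerNoRange`;
  the §7 case split is done at SET level ("some pair `f i ∪ f j` separates `F`" vs. pants type).
* `helper_dependentTripleGenusThreeStandard_of_four` (REGISTERED helper; the line's REDUCTION
  theorem) — the crux BY NAME from four explicit hypotheses, verbatim the four registered stubs: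
  the Thm. 1.3 fact `az2025_weaklyReducible_genusThree_homotopySphere_gk.{0}` (= sibling item
  `GenusThreeBase`), the classification `msz_trisection_classification_gk.{0}` (MSZ16 Thm. 1.2),
  stub 3 and stub 4.  When the four land, the crux closes by this theorem in one line.

No new definition, no named fact; pure logic over proved tree theorems.

References: R. Aranda, A. Zupan, arXiv:2503.04607 (2025), Lemma 5.4, Prop. 5.5 (pp. 19–20), §7
(pp. 25–26); J. Meier, T. Schirmer, A. Zupan, PAMS 144 (2016), Thm. 1.2 and Remark 3.12; D. Gay,
R. Kirby, Geom. Topol. 20 (2016), Remark 2.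
-/

-- the registered namespace `Summit.SmoothPoincare4.SmoothPoincare4.Theorems…` repeats a component
set_option linter.dupNamespace false

noncomputable section

open scoped Manifold ContDiff Topology ContinuousMap
open Set
open Literature.Topology.FourManifolds
open Literature.Topology.FourManifolds.Trisection

namespace Summit.SmoothPoincare4.SmoothPoincare4.Theorems

/-- **The Meier–Schirmer–Zupan range of a low-genus trisected loop partner of a homotopy 4-sphere
is automatic** (the free half of Aranda–Zupan's Lemma 5.4 type statement).  If `M ≃ₕ S⁴` is a
circle surgery on the loop `ℓ ⊂ X′` and `X′` carries a `(g′; k′)`-GK-trisection with `g′ ≤ 2`,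
then `∃ i, g′ ≤ k′ i + 1`: the loop is smooth (core of the surgery's tubular neighbourhood), `X′`
is compact, connected and orientable, so `k′₀ + k′₁ + k′₂ = g′ + 2` (`χ(X′) = χ(M) − 2 = 0`), and
for `g′ ≤ 1` the clause is trivial while for `g′ = 2` a sum of `4` over three indices has a term
`≥ 1`. [cite: GayKirby2016, Remark 2] [cite: MeierSchirmerZupan2016, Remark 3.12] [cite: ArandaZupan2025, Lemma 5.4 (p. 19)] -/
theorem mszRange_of_isCircleSurgery_of_genus_le_two
    {X' : Type} [TopologicalSpace X'] [T2Space X'] [SecondCountableTopology X']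
    [ChartedSpace (EuclideanSpace ℝ (Fin 4)) X'] [IsManifold (𝓡 4) ∞ X']
    {g' : ℕ} {k' : Fin 3 → ℕ} {T' : Fin 3 → Set X'} (hg' : g' ≤ 2)
    (hT' : IsGKTrisection X' g' k' T')
    {ℓ : Metric.sphere (0 : EuclideanSpace ℝ (Fin 2)) 1 → X'}
    {M : Type} [TopologicalSpace M] [T2Space M] [SecondCountableTopology M]
    [ChartedSpace (EuclideanSpace ℝ (Fin 4)) M] [IsManifold (𝓡 4) ∞ M] (e : M ≃ₕ (Metric.sphere (0 : EuclideanSpace ℝ (Fin 5)) 1))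
    (hs : IsCircleSurgery (𝓡 4) (𝓡 4) X' M ℓ) : ∃ i, g' ≤ k' i + 1 := by
  have hℓ : Manifold.IsSmoothEmbedding (𝓡 1) (𝓡 4) ∞ ℓ := by
    obtain ⟨ν, -⟩ := hs
    exact ν.isSmoothEmbedding_core
  haveI : CompactSpace X' := hT'.compactSpace
  haveI : ConnectedSpace X' := hT'.connectedSpace
  have hM : IsOrientable (𝓡 4) M := isOrientable_of_homotopyEquiv_sphere_four_holds M e
  have hX' : IsOrientable (𝓡 4) X' := isOrientable_of_isCircleSurgery_four_holds X' ℓ M hs hM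
  have hsum : k' 0 + k' 1 + k' 2 = g' + 2 :=
    gkTrisection_sum_eq_add_two_of_loopSurgery_homotopySphere_holds X' hX' g' k' T' hT' ℓ hℓ M e hs
  by_contra h
  push Not at h
  have h0 := h 0
  have h1 := h 1
  have h2 := h 2
  omega

/-- **A homotopy 4-sphere that is a circle surgery on a genus-`≤ 2` trisected `X′` is `S⁴`, GIVEN
the loop-surgery fact** (`msz_loopSurgery_homotopySphere_gk`: Meier–Schirmer–Zupan Thm. 1.2 +
Pao).  The smoothness of the loop and the MSZ range are derived
(`mszRange_of_isCircleSurgery_of_genus_le_two`), the side conditions on `X′` by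
`Literature.Barriers.SmoothPoincare4.nonempty_diffeomorph_sphere_of_isCircleSurgery_of_mszRange`.
[cite: MeierSchirmerZupan2016, Thm. 1.2] [cite: ArandaZupan2025, §2 p. 7 and §7 pp. 25–26] -/
theorem nonempty_diffeomorph_sphere_of_isCircleSurgery_of_genus_le_two
    (hL : msz_loopSurgery_homotopySphere_gk)
    {X' : Type} [TopologicalSpace X'] [T2Space X'] [SecondCountableTopology X']
    [ChartedSpace (EuclideanSpace ℝ (Fin 4)) X'] [IsManifold (𝓡 4) ∞ X']
    {g' : ℕ} {k' : Fin 3 → ℕ} {T' : Fin 3 → Set X'} (hg' : g' ≤ 2)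
    (hT' : IsGKTrisection X' g' k' T')
    {ℓ : Metric.sphere (0 : EuclideanSpace ℝ (Fin 2)) 1 → X'}
    {M : Type} [TopologicalSpace M] [T2Space M] [SecondCountableTopology M]
    [ChartedSpace (EuclideanSpace ℝ (Fin 4)) M] [IsManifold (𝓡 4) ∞ M] (e : M ≃ₕ (Metric.sphere (0 : EuclideanSpace ℝ (Fin 5)) 1))
    (hs : IsCircleSurgery (𝓡 4) (𝓡 4) X' M ℓ) : Nonempty (M ≃ₘ⟮𝓡 4, 𝓡 4⟯ (Metric.sphere (0 : EuclideanSpace ℝ (Fin 5)) 1)) := by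
  have hℓ : Manifold.IsSmoothEmbedding (𝓡 1) (𝓡 4) ∞ ℓ := by
    obtain ⟨ν, -⟩ := hs
    exact ν.isSmoothEmbedding_core
  exact Literature.Barriers.SmoothPoincare4.nonempty_diffeomorph_sphere_of_isCircleSurgery_of_mszRange
    hL hT' (mszRange_of_isCircleSurgery_of_genus_le_two hg' hT' e hs) hℓ hs e

/-- **REGISTERED helper of crux stmt-SmoothPoincare4-18000 (line `Sketch`, skeleton v2): the
pants-triple statement `hp` at type `(1,1,1)` from the loop-surgery fact and the weakened
loop-partner step.**  Output: verbatim the hypothesis `hp` of the tree's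
`notWeaklyReducibleCore_of_separatingPair_of_pantsTriple_type (fun _ => 1)`; second input: verbatim
the registered apex stub `stub_loopPartnerNoRange` (a `(3; 1,1,1)`-trisected `M ≃ₕ S⁴` with a
pants-type triple, not weakly reducible, is `IsCircleSurgery X′ M ℓ` for some `X′` with a
GK-trisection of genus `≤ 2`).  Aranda–Zupan §7 configuration (3) ends exactly so: "`X` is
obtained by surgery on a loop `ℓ` in a manifold `X′` admitting a `(2; k₁, k₂, k₃)` trisection".
[cite: ArandaZupan2025, §7 (pp. 25–26), Lemma 5.4 and Prop. 5.5 (pp. 19–20)] [cite: MeierSchirmerZupan2016, Thm. 1.2] -/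
theorem helper_pantsTriple_of_loopSurgery_of_loopPartnerNoRange :
    msz_loopSurgery_homotopySphere_gk →
    (∀ (M : Type) [TopologicalSpace M] [T2Space M] [SecondCountableTopology M]
      [ChartedSpace (EuclideanSpace ℝ (Fin 4)) M] [IsManifold (𝓡 4) ∞ M],
      M ≃ₕ (Metric.sphere (0 : EuclideanSpace ℝ (Fin 5)) 1) → ∀ T : Fin 3 → Set M, IsGKTrisection M 3 (fun _ => 1) T →
      ∀ f : Fin 3 → Set M,
      ((∀ i, IsCurve T (f i)) ∧ (Pairwise fun i j => Disjoint (f i) (f j)) ∧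
        (∀ i, IsNonSeparating T (f i)) ∧ (∀ i, BoundsDisc T (spineHandlebody T i) (f i)) ∧
        (∀ i j, i ≠ j → IsConnected (centralSurfaceSet T \ (f i ∪ f j))) ∧
        ¬ IsPreconnected (centralSurfaceSet T \ ⋃ i, f i)) →
      ¬ IsWeaklyReducible T →
      ∃ (X' : Type) (_ : TopologicalSpace X') (_ : T2Space X') (_ : SecondCountableTopology X')
        (_ : ChartedSpace (EuclideanSpace ℝ (Fin 4)) X') (_ : IsManifold (𝓡 4) ∞ X')
        (g' : ℕ) (k' : Fin 3 → ℕ) (T' : Fin 3 → Set X')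
        (ℓ : Metric.sphere (0 : EuclideanSpace ℝ (Fin 2)) 1 → X'),
        g' ≤ 2 ∧ IsGKTrisection X' g' k' T' ∧ IsCircleSurgery (𝓡 4) (𝓡 4) X' M ℓ) →
    ∀ (M : Type) [TopologicalSpace M] [T2Space M] [SecondCountableTopology M]
      [ChartedSpace (EuclideanSpace ℝ (Fin 4)) M] [IsManifold (𝓡 4) ∞ M],
      M ≃ₕ (Metric.sphere (0 : EuclideanSpace ℝ (Fin 5)) 1) → ∀ T : Fin 3 → Set M, IsGKTrisection M 3 (fun _ => 1) T →
      ∀ f : Fin 3 → Set M,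
      ((∀ i, IsCurve T (f i)) ∧ (Pairwise fun i j => Disjoint (f i) (f j)) ∧
        (∀ i, IsNonSeparating T (f i)) ∧ (∀ i, BoundsDisc T (spineHandlebody T i) (f i)) ∧
        (∀ i j, i ≠ j → IsConnected (centralSurfaceSet T \ (f i ∪ f j))) ∧
        ¬ IsPreconnected (centralSurfaceSet T \ ⋃ i, f i)) →
      ¬ IsWeaklyReducible T → Nonempty (M ≃ₘ⟮𝓡 4, 𝓡 4⟯ (Metric.sphere (0 : EuclideanSpace ℝ (Fin 5)) 1)) := by
  intro hL hP M _ _ _ _ _ e T hT f hf hwr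
  obtain ⟨X', _, _, _, _, _, g', k', T', ℓ, hg', hT', hs⟩ := hP M e T hT f hf hwr
  exact nonempty_diffeomorph_sphere_of_isCircleSurgery_of_genus_le_two hL hg' hT' e hs

/-- **REGISTERED helper (line `Sketch`, v3): the not-weakly-reducible core at type `(1,1,1)` from
the loop-surgery fact and the two Aranda–Zupan-specific stubs** — the §7 case split at SET level:
write the dependent triple in indexed form (`hasDependentTriple_iff_exists_fun`); if some pair
`f i ∪ f j` separates the central surface (configurations (1)–(2) of p. 24), the separating-pair
stub contradicts `¬ IsWeaklyReducible T` (p. 25: "the trisection `𝒯` is again weakly reducible");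
otherwise `f` is of pants type (configuration (3)) and the loop-partner stub with the endgame
`helper_pantsTriple_of_loopSurgery_of_loopPartnerNoRange` applies.  Output: verbatim the hypothesis
`hcore` of `arandaZupan_dependentTriple_genusThree_homotopySphere_of_facts_of_notWeaklyReducible`.
[cite: ArandaZupan2025, §7 (pp. 24–26)] -/
theorem helper_notWeaklyReducibleCore_of_stubs :
    msz_loopSurgery_homotopySphere_gk →
    (∀ (M : Type) [TopologicalSpace M] [T2Space M] [SecondCountableTopology M]
      [ChartedSpace (EuclideanSpace ℝ (Fin 4)) M] [IsManifold (𝓡 4) ∞ M],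
      M ≃ₕ (Metric.sphere (0 : EuclideanSpace ℝ (Fin 5)) 1) → ∀ T : Fin 3 → Set M, IsGKTrisection M 3 (fun _ => 1) T →
      ∀ f : Fin 3 → Set M,
      (∀ i, IsCurve T (f i)) → (Pairwise fun i j => Disjoint (f i) (f j)) →
      (∀ i, IsNonSeparating T (f i)) → (∀ i, BoundsDisc T (spineHandlebody T i) (f i)) →
      ¬ IsPreconnected (centralSurfaceSet T \ ⋃ i, f i) →
      ∀ i j : Fin 3, i ≠ j → ¬ IsConnected (centralSurfaceSet T \ (f i ∪ f j)) →
      IsWeaklyReducible T) →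
    (∀ (M : Type) [TopologicalSpace M] [T2Space M] [SecondCountableTopology M]
      [ChartedSpace (EuclideanSpace ℝ (Fin 4)) M] [IsManifold (𝓡 4) ∞ M],
      M ≃ₕ (Metric.sphere (0 : EuclideanSpace ℝ (Fin 5)) 1) → ∀ T : Fin 3 → Set M, IsGKTrisection M 3 (fun _ => 1) T →
      ∀ f : Fin 3 → Set M,
      ((∀ i, IsCurve T (f i)) ∧ (Pairwise fun i j => Disjoint (f i) (f j)) ∧
        (∀ i, IsNonSeparating T (f i)) ∧ (∀ i, BoundsDisc T (spineHandlebody T i) (f i)) ∧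
        (∀ i j, i ≠ j → IsConnected (centralSurfaceSet T \ (f i ∪ f j))) ∧
        ¬ IsPreconnected (centralSurfaceSet T \ ⋃ i, f i)) →
      ¬ IsWeaklyReducible T →
      ∃ (X' : Type) (_ : TopologicalSpace X') (_ : T2Space X') (_ : SecondCountableTopology X')
        (_ : ChartedSpace (EuclideanSpace ℝ (Fin 4)) X') (_ : IsManifold (𝓡 4) ∞ X')
        (g' : ℕ) (k' : Fin 3 → ℕ) (T' : Fin 3 → Set X')
        (ℓ : Metric.sphere (0 : EuclideanSpace ℝ (Fin 2)) 1 → X'),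
        g' ≤ 2 ∧ IsGKTrisection X' g' k' T' ∧ IsCircleSurgery (𝓡 4) (𝓡 4) X' M ℓ) →
    ∀ (M : Type) [TopologicalSpace M] [T2Space M] [SecondCountableTopology M]
      [ChartedSpace (EuclideanSpace ℝ (Fin 4)) M] [IsManifold (𝓡 4) ∞ M],
      M ≃ₕ (Metric.sphere (0 : EuclideanSpace ℝ (Fin 5)) 1) → ∀ T : Fin 3 → Set M, IsGKTrisection M 3 (fun _ => 1) T →
        HasDependentTriple T → ¬ IsWeaklyReducible T → Nonempty (M ≃ₘ⟮𝓡 4, 𝓡 4⟯ (Metric.sphere (0 : EuclideanSpace ℝ (Fin 5)) 1)) := by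
  intro hL h12 h3 M _ _ _ _ _ e T hT hdt hwr
  rw [hasDependentTriple_iff_exists_fun] at hdt
  obtain ⟨f, hcur, hdis, hns, hbd, hdep⟩ := hdt
  by_cases hconn : ∀ i j : Fin 3, i ≠ j → IsConnected (centralSurfaceSet T \ (f i ∪ f j))
  · -- configuration (3): a pants-type triple
    exact helper_pantsTriple_of_loopSurgery_of_loopPartnerNoRange hL h3 M e T hT f
      ⟨hcur, hdis, hns, hbd, hconn, hdep⟩ hwr
  · -- configurations (1)–(2): some pair separates
    push Not at hconn
    obtain ⟨i, j, hij, hsep⟩ := hconn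
    exact absurd (h12 M e T hT f hcur hdis hns hbd hdep i j hij hsep) hwr

/-- **REGISTERED helper — THE REDUCTION OF THE LINE (crux ⇐ four stubs, sorry-free).**  The route
item `DependentTripleGenusThreeStandard` (Aranda–Zupan 2025 Thm. 1.4 / Cor. 1.5 for homotopy
4-spheres) from four explicit hypotheses, verbatim the four registered stubs of
`Cruxes/DependentTripleGenusThreeStandard/Lines/Sketch.lean` (v3):
(1) the Thm. 1.3 fact `az2025_weaklyReducible_genusThree_homotopySphere_gk.{0}` (sibling item
`GenusThreeBase`); (2) Meier–Schirmer–Zupan's classification `msz_trisection_classification_gk.{0}`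
(it yields `msz_homotopySphere_gk`, used to reduce to `k = (1,1,1)`, and the loop-surgery fact);
(3) the separating-pair stub; (4) the loop-partner stub.  Proof: the tree's
`…_of_facts_of_notWeaklyReducible` with `helper_notWeaklyReducibleCore_of_stubs`, then the route
closing term `dependentTripleGenusThreeStandard_of_arandaZupan` (p156575).
[cite: ArandaZupan2025, Thm. 1.3, Thm. 1.4 and Cor. 1.5 (p. 2), §7 (pp. 24–26)] [cite: MeierSchirmerZupan2016, Thm. 1.2] -/
theorem helper_dependentTripleGenusThreeStandard_of_four :
    Literature.Barriers.SmoothPoincare4.az2025_weaklyReducible_genusThree_homotopySphere_gk.{0} →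
    msz_trisection_classification_gk.{0} →
    (∀ (M : Type) [TopologicalSpace M] [T2Space M] [SecondCountableTopology M]
      [ChartedSpace (EuclideanSpace ℝ (Fin 4)) M] [IsManifold (𝓡 4) ∞ M],
      M ≃ₕ (Metric.sphere (0 : EuclideanSpace ℝ (Fin 5)) 1) → ∀ T : Fin 3 → Set M, IsGKTrisection M 3 (fun _ => 1) T →
      ∀ f : Fin 3 → Set M,
      (∀ i, IsCurve T (f i)) → (Pairwise fun i j => Disjoint (f i) (f j)) →
      (∀ i, IsNonSeparating T (f i)) → (∀ i, BoundsDisc T (spineHandlebody T i) (f i)) →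
      ¬ IsPreconnected (centralSurfaceSet T \ ⋃ i, f i) →
      ∀ i j : Fin 3, i ≠ j → ¬ IsConnected (centralSurfaceSet T \ (f i ∪ f j)) →
      IsWeaklyReducible T) →
    (∀ (M : Type) [TopologicalSpace M] [T2Space M] [SecondCountableTopology M]
      [ChartedSpace (EuclideanSpace ℝ (Fin 4)) M] [IsManifold (𝓡 4) ∞ M],
      M ≃ₕ (Metric.sphere (0 : EuclideanSpace ℝ (Fin 5)) 1) → ∀ T : Fin 3 → Set M, IsGKTrisection M 3 (fun _ => 1) T →
      ∀ f : Fin 3 → Set M,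
      ((∀ i, IsCurve T (f i)) ∧ (Pairwise fun i j => Disjoint (f i) (f j)) ∧
        (∀ i, IsNonSeparating T (f i)) ∧ (∀ i, BoundsDisc T (spineHandlebody T i) (f i)) ∧
        (∀ i j, i ≠ j → IsConnected (centralSurfaceSet T \ (f i ∪ f j))) ∧
        ¬ IsPreconnected (centralSurfaceSet T \ ⋃ i, f i)) →
      ¬ IsWeaklyReducible T →
      ∃ (X' : Type) (_ : TopologicalSpace X') (_ : T2Space X') (_ : SecondCountableTopology X')
        (_ : ChartedSpace (EuclideanSpace ℝ (Fin 4)) X') (_ : IsManifold (𝓡 4) ∞ X')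
        (g' : ℕ) (k' : Fin 3 → ℕ) (T' : Fin 3 → Set X')
        (ℓ : Metric.sphere (0 : EuclideanSpace ℝ (Fin 2)) 1 → X'),
        g' ≤ 2 ∧ IsGKTrisection X' g' k' T' ∧ IsCircleSurgery (𝓡 4) (𝓡 4) X' M ℓ) →
    Summit.SmoothPoincare4.SmoothPoincare4.Theses.WeakReductionDescent.DependentTripleGenusThreeStandard := by
  intro h1 h2 h12 h3
  exact dependentTripleGenusThreeStandard_of_arandaZupan
    (arandaZupan_dependentTriple_genusThree_homotopySphere_of_facts_of_notWeaklyReducible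
      (Literature.Barriers.SmoothPoincare4.az2025_weaklyReducible_genusThree_homotopySphere_gk_iff_routeShape_univ.mp
        h1)
      (Literature.Barriers.SmoothPoincare4.msz_homotopySphere_gk_of_univ
        (Literature.Barriers.SmoothPoincare4.msz_homotopySphere_gk_of_classification h2))
      (helper_notWeaklyReducibleCore_of_stubs
        (msz_loopSurgery_homotopySphere_gk_of_classification h2) h12 h3))

end Summit.SmoothPoincare4.SmoothPoincare4.Theorems

end
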